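import Summits.QuantumFields.YangMills.Theorems.UnitScaleTiltProp7AxialFramePairRows
import Summits.QuantumFields.YangMills.Theorems.UnitScaleTiltProp7TentWeightsZd
import Summits.QuantumFields.YangMills.Theorems.UnitScaleTiltProp7OneShotAxialFrameRows
import HarnessLib

/-!
# Route `UnitScaleTilt`, crux K1 «MinimiserStabilityRegPr» (stmt-QuantumFields-19200) — route-R E′ (A′), LANE II «DIVERGENCE RECOVERY AT CURVED `W`» (★★OWNER RULING №23),
# brick (B2a), sub-pen F4 (px3 g6), FILE F4-W-MEMBER: **THE THREE FRAME SLOTS OF THE COVARIANT TENT `I_σ` AT A PRINTED-REGULAR BACKGROUND** — the member readings, at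
# `V := W♯ = pull (bgUnits F K W) (basePt F n K)`, `ℓ = L^{K−n}`, `Y z = ⌊z∕L⌋^[K−n]`, tent roots `ℓ·(Y z − δ)`, `δ ∈ {0,1}³`, of px3 g6's `ℤᵈ` rows ✓`Prop7AxialFramePairRows` (F4-W) and
# px5 g6's ✓`Prop7CombVsAxialTransport` (F3): (M-THIN) `‖σ_{Y−δ}(z)·W♯(z,μ)·σ_{Y−δ}(z+e_μ)⁻¹ − 1‖ ≤ 12·ε·η`; (M-FAT) `‖σ_Y(z)·σ_{Y−δ}(z)⁻¹ − T(staircase Y−δ → Y)⁻¹‖ ≤ (36 + 3·CT)·ε`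
# under the (B3c) closeness rider of ★p1 g19's (B2a) SIGNATURE-0 (inhabited by ⧗p706536); (M-REP) `‖τ_W(Y,z)·σ_Y(z)⁻¹ − 1‖ ≤ 7308·(2ε)` and `τ_W(Y,z) ∈ U1` within an L-only radius
# (`τ_W = compT L (bgT L W♯) (K−n)`, print's comb transporter of (3.19)).  Statement texts = px3 g6's SIGNATURE-0 `SIGNATURE0-F4W-MemberRows-for-px15` (d2102c23) VERBATIM.

Cell `ym3-torus` ∕ width seat `ym3-torus-px15` (gen 5), second hand of px3 g6 (07:44:05Z GO).  THEOREMS ONLY (0 `def`, 0 `sorry`); `--supports stmt-QuantumFields-19200 --as helper`,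
count-neutral.  YM₃ on T³ is a ladder rung (R3) — NOT d = 4, NOT infinite volume, NOT a mass gap, NOT the Clay problem; nothing here claims (B2a), (REC), `hN06`, E′, EX, the crux or the gap.

THE PRINT.  [Balaban1985Averaging] p. 24 (the axial gauge rooted at a box corner, `|V₀(x, x+e_μ) − 1| < |x − y|·α₀`), (42)–(43) pp. 23–24 and (78)–(80) p. 30 (the comb transporters
`Ūʲ(Γ_{Ly,x})`), Prop. 2 (52)–(54) p. 26 (the tower stays small∕unitary); [Balaban1985BackgroundPropagators] (3.19) p. 393 (`Q′` through the composite comb transporter);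
[Balaban1985RegularSpaces] (1.7) p. 77 (the plaquette clause of the regular space, here `T3PrintedRegularMinimiser.RegPr` = [Balaban1985Variational] (2) p. 278).

WHAT IS PROVED (ns `…Theorems.Prop7TentFrameRowsOfRegPr`).  §1 dictionaries (`blockBase ℓ Y = ℓ•Y`, the tent root below the site in the member's iterate letter, `l1 (z − ℓ·Y z) ≤ 3(ℓ−1)`,
the coarse `T`-field read on `ℤ³` is `U1`-valued and — under the (B3c) rider — `CT·ε`-close to the straight `ℓ`-segments of `W♯`, `compT` of `U1`-valued legs is `U1`-valued, the ratio
form `‖τσ⁻¹ − 1‖ ≤ ‖τ − σ‖`); §2 ★ `tentFrame_thin_of_regPr`; §3 ★★ `tentFrame_fat_of_regPr`; §4 ★★ `tentFrame_rep_of_regPr` (radius `e₃ L := min (6·C₀(3))⁻¹ (c₂′(3,L)∕4)`).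
HONEST SCOPE.  Member bookkeeping over three landed `ℤᵈ` theorems; no estimate of print re-derived; rung R3, not Clay; YM gap NOT proved.

References: T. Bałaban, CMP **98** (1985) 17–51 [Balaban1985Averaging] (pp.24–25, (42)–(43) pp.23–24, (52)–(54) p.26, (78)–(80) p.30); CMP **99** (1985) 75–102 [Balaban1985RegularSpaces]
((1.3), (1.7) p.77, Lemma 1 (1.25) p.79); CMP **99** (1985) 389–434 [Balaban1985BackgroundPropagators] ((3.17)–(3.19) p.393); CMP **102** (1985) 277–309 [Balaban1985Variational] ((2) p.278).
-/

set_option autoImplicit false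

noncomputable section

open scoped Matrix.Norms.L2Operator BigOperators

namespace Summit.QuantumFields.YangMills.Theorems.Prop7TentFrameRowsOfRegPr

open Literature.MathematicalPhysics.QuantumFieldTheory.Balaban1983to89
open Literature.MathematicalPhysics.QuantumFieldTheory.Balaban1983to89.T3ContinuumYM3Torus
open Literature.MathematicalPhysics.QuantumFieldTheory.Balaban1983to89.T3PrintedRegularMinimiser (RegPr)
open Literature.MathematicalPhysics.QuantumLattice (blockMap blockBase)
open B7Prop1Explicit renaming Site → LSite
open B7Prop1Explicit (U1 mem_U1 axialFn e e_apply treeWord seg seg_natCast hol l1 hol_mem axialFn_mem)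
open B7Prop2Explicit (pdev le_pdev pdev_nonneg C0 c2' C0_pos c2'_pos unitaryUnits_le_U1)
open B7Prop2SpecialUnitary (specialUnitaryUnits_le_unitaryUnits)
open B7AvgClosedSpecialUnitarySharp (avgClosed_specialUnitary_of_le_twentyone)
open B8Eq119TwistedAxial (bgT)
open B9B8AveragingKernelZd (blockIter compT compT_zero compT_succ mem_blockIter_iff)
open B9Eq325QprimeSingleSiteZd (blockMapIter_eq_blockMap_pow)
open B9Thm31GpAgmonDecayCoarseZd (blockMapIter_eq_iterate)
open B10Eq27TorusAxialLog (transl pull pull_apply holT unitsField toUField hol_pull)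
open T4TermwiseTorus (tlift tcls tcls_tlift tcls_eq_tcls_iff)
open T3SectALandauChart (bgUnits eta eta_pos pos_of_regPr)
open Summit.QuantumFields.YangMills.Theorems.Prop7SPrint (basePt)
open Summit.QuantumFields.YangMills.Theorems.Prop7QprimeCombL2 (sitesPerDir_zero_eq)
open Summit.QuantumFields.YangMills.Theorems.Prop7QprimeCombBumpSectionRows (pull_bgUnits_mem_U1 transl_zero_eq_tcls)
open Summit.QuantumFields.YangMills.Theorems.Prop7LandauCombDict (transl_add_period bgT_pull_mem_unitaryUnits_of_regPr)
open Summit.QuantumFields.YangMills.Theorems.Prop7AxialReprPrint (inAk_pull_of_regPr pdev_pull_lt pull_toUField_mem)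
open Summit.QuantumFields.YangMills.Theorems.Prop7OneShotAxialFrameRows (pdev_pull_le_of_regPr hol_add_period)
open Summit.QuantumFields.YangMills.Theorems.Prop7CombVsAxialTransport (l1_le_mul_of_le norm_compT_bgT_sub_axialFn_le)
open Summit.QuantumFields.YangMills.Theorems.Prop7AxialFramePairRows (norm_axialFrame_bond_sub_one_le norm_frameRatio_sub_inv_hol_treeWord_le)
open Summit.QuantumFields.YangMills.Theorems.Prop7TentWeightsZd (root_le sub_root_le offset_mem)

/-! ## §1 Dictionaries -/

section Zd

variable {d : ℕ}

/-- `ℓ·Y` as a scalar multiple: `blockBase ℓ Y = (ℓ : ℤ) • Y`. [folklore; cite: Balaban1985Averaging, (2) p.17] -/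
theorem blockBase_eq_smul (ℓ : ℕ) (Y : LSite d) : blockBase ℓ Y = (ℓ : ℤ) • Y := by
  funext i; simp [blockBase]

/-- `⌊·∕L⌋^[k] = ⌊·∕Lᵏ⌋` (lit ✓`blockMapIter_eq_iterate` ∘ ✓`blockMapIter_eq_blockMap_pow`, restated inline for `rw`). [cite: Balaban1985Averaging, (52)–(53) p.27] -/
theorem iterate_blockMap_apply (L k : ℕ) (x : LSite d) : (blockMap L)^[k] x = blockMap (L ^ k) x := by
  rw [← blockMapIter_eq_iterate L k x, blockMapIter_eq_blockMap_pow]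

/-- The own-box offset has `ℓ¹`-norm `≤ d·(ℓ − 1)`: `|z − ℓ·⌊z∕ℓ⌋|₁ ≤ d(ℓ−1)`. [cite: Balaban1985Averaging, (2) p.17, (52)–(53) p.27] -/
theorem l1_sub_blockBase_blockMap_le {ℓ : ℕ} (hℓ : 0 < ℓ) (z : LSite d) : l1 (z - blockBase ℓ (blockMap ℓ z)) ≤ d * (ℓ - 1) :=
  l1_le_mul_of_le (fun i => by have := (offset_mem hℓ z i).1; simpa [blockBase] using this) fun i => by
    have := (offset_mem hℓ z i).2
    have h1 : 1 ≤ ℓ := hℓ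
    simp only [Pi.sub_apply, blockBase, Nat.cast_sub h1, Nat.cast_one]
    omega

variable {𝔸 : Type*} [NormedRing 𝔸] [NormOneClass 𝔸]

/-- `compT` of `U1`-valued legs is `U1`-valued. [cite: Balaban1985BackgroundPropagators, (3.19) p.393] -/
theorem compT_mem_U1 (L : ℕ) (T : ℕ → LSite d → LSite d → 𝔸ˣ) {k : ℕ} (hT : ∀ j, j < k → ∀ y x, T j y x ∈ U1 𝔸) :
    ∀ j, j ≤ k → ∀ y x, compT L T j y x ∈ U1 𝔸
  | 0, _, y, x => by rw [compT_zero]; exact (U1 𝔸).one_mem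
  | j + 1, hj, y, x => by
    rw [compT_succ]
    exact (U1 𝔸).mul_mem (hT j (by omega) _ _) (compT_mem_U1 L T hT j (by omega) _ _)

/-- The ratio form: `‖τ·σ⁻¹ − 1‖ ≤ ‖τ − σ‖` for `σ ∈ U1`. [folklore] -/
theorem norm_mul_inv_sub_one_le {τ σ : 𝔸ˣ} (hσ : σ ∈ U1 𝔸) : ‖((τ * σ⁻¹ : 𝔸ˣ) : 𝔸) - 1‖ ≤ ‖(τ : 𝔸) - (σ : 𝔸)‖ := by
  have hid : ((τ * σ⁻¹ : 𝔸ˣ) : 𝔸) - 1 = ((τ : 𝔸) - (σ : 𝔸)) * ((σ⁻¹ : 𝔸ˣ) : 𝔸) := by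
    rw [sub_mul, Units.val_mul, Units.mul_inv]
  rw [hid]
  calc _ ≤ ‖(τ : 𝔸) - (σ : 𝔸)‖ * ‖((σ⁻¹ : 𝔸ˣ) : 𝔸)‖ := norm_mul_le _ _
    _ ≤ ‖(τ : 𝔸) - (σ : 𝔸)‖ * 1 := by gcongr; exact (mem_U1.1 hσ).2
    _ = _ := mul_one _

end Zd

/-! ## §2–§4 The member -/

section Member

variable (F : T3Family) (n K : ℕ)

/-- The based pullback of a level-`j` `U1`-valued torus field is `U1`-valued on `ℤ³`. [cite: Balaban1985Averaging, (19) p.21] -/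
theorem pull_mem_U1_of {j : ℕ} {T : GaugeField (F.P K) j (Matrix (Fin 2) (Fin 2) ℂ)ˣ} (hT : ∀ c, T c ∈ U1 (Matrix (Fin 2) (Fin 2) ℂ)) (x₀ : Site (F.P K) j)
    (Y : LSite (F.P K).d) (κ : Fin (F.P K).d) : pull T x₀ Y κ ∈ U1 (Matrix (Fin 2) (Fin 2) ℂ) := by
  rw [pull_apply]; exact hT _

/-- **THE (B3c) RIDER READ ON `ℤ³`**: if `T` is `CT·ε`-close to the straight `ℓ`-segments of `W` between the box corners (★p1 g19's SIGNATURE-0 rider, ⧗p706536), then the pulled-back coarse field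
`pull T 0` is `CT·ε`-close to the straight `ℓ`-segments of `W♯` from `ℓ·Y`, for EVERY `Y ∈ ℤ³` (periodicity: `tlift (tcls Y) = Y + N_k·m`, `ℓ·N_k = N₀`).
[cite: Balaban1985Averaging, (9) p.18, (43) p.24; Balaban1985RegularSpaces, (1.3) p.77] -/
theorem norm_pull_sub_hol_seg_le (hnK : n ≤ K) (W : GaugeField (F.P K) 0 (Matrix.specialUnitaryGroup (Fin 2) ℂ)) {CT ε : ℝ}
    (T : PBond (F.P K) (K - n) → (Matrix (Fin 2) (Fin 2) ℂ)ˣ)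
    (hclose : ∀ c : PBond (F.P K) (K - n),
      ‖(T c : Matrix (Fin 2) (Fin 2) ℂ) - ((holT (unitsField (toUField W)) (transl (basePt F n K) (blockBase ((F.P K).L ^ (K - n)) (tlift c.src)))
          (List.replicate ((F.P K).L ^ (K - n)) (c.dir, true)) : (Matrix (Fin 2) (Fin 2) ℂ)ˣ) : Matrix (Fin 2) (Fin 2) ℂ)‖ ≤ CT * ε)
    (Y : LSite (F.P K).d) (κ : Fin (F.P K).d) :
    ‖((pull T 0 Y κ : (Matrix (Fin 2) (Fin 2) ℂ)ˣ) : Matrix (Fin 2) (Fin 2) ℂ)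
        - ((hol (pull (bgUnits F K W) (basePt F n K)) ((((F.P K).L ^ (K - n) : ℕ) : ℤ) • Y) (seg κ (((F.P K).L ^ (K - n) : ℕ) : ℤ)) :
            (Matrix (Fin 2) (Fin 2) ℂ)ˣ) : Matrix (Fin 2) (Fin 2) ℂ)‖ ≤ CT * ε := by
  set Nk := (F.P K).sitesPerDir (K - n) with hNk
  set c : PBond (F.P K) (K - n) := ⟨transl 0 Y, κ⟩ with hc
  have h := hclose c
  -- `tlift c.src = Y + N_k • m`
  have hsrc : c.src = tcls Nk Y := by rw [hc]; exact transl_zero_eq_tcls Y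
  obtain ⟨m, hm⟩ : ∃ m : LSite (F.P K).d, tlift (c.src) = Y + ((Nk : ℕ) : ℤ) • m :=
    (tcls_eq_tcls_iff (T := Nk)).1 (by rw [hsrc, tcls_tlift])
  -- the straight segment read on the pullback
  have hseg : hol (pull (bgUnits F K W) (basePt F n K)) ((((F.P K).L ^ (K - n) : ℕ) : ℤ) • Y) (seg κ (((F.P K).L ^ (K - n) : ℕ) : ℤ))
      = holT (unitsField (toUField W)) (transl (basePt F n K) (blockBase ((F.P K).L ^ (K - n)) (tlift c.src))) (List.replicate ((F.P K).L ^ (K - n)) (c.dir, true)) := by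
    rw [hol_pull, seg_natCast, hm]
    have hb : blockBase ((F.P K).L ^ (K - n)) (Y + ((Nk : ℕ) : ℤ) • m)
        = (((F.P K).L ^ (K - n) : ℕ) : ℤ) • Y + (((F.P K).sitesPerDir 0 : ℕ) : ℤ) • m := by
      rw [sitesPerDir_zero_eq F n K hnK]
      funext i
      simp only [blockBase, Pi.add_apply, Pi.smul_apply, smul_eq_mul, Nat.cast_mul, hNk]
      ring
    rw [hb, transl_add_period]
    rfl
  rw [hseg, pull_apply]
  exact h

/-- ★ **(M-THIN) — the eight tent frames across one fine bond, at `RegPr`: `≤ 12·ε·η`** (px3's ✓`norm_axialFrame_bond_sub_one_le` at the root `ℓ·(Y z − δ)` — ✓`root_le`∕✓`sub_root_le`: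
root `≤ z`, `z − root ≤ 2ℓ − 1 ≤ 2ℓ` —, `a := pdev W♯ ≤ 2εη²` ✓`pdev_pull_le_of_regPr`, `(3·2ℓ)·2εη² = 12εη` by `ℓη = 1`).  The `hthin` slot of ✓`norm_covTent_grad_le` at the member.
[cite: Balaban1985Averaging, pp.24–25; Balaban1985RegularSpaces, (1.7) p.77, Lemma 1 (1.25) p.79] -/
theorem tentFrame_thin_of_regPr {ε : ℝ} {W : GaugeField (F.P K) 0 (Matrix.specialUnitaryGroup (Fin 2) ℂ)} (hW : RegPr F n K ε W)
    (z : LSite (F.P K).d) (μ : Fin (F.P K).d) (δ : Fin (F.P K).d → Fin 2) :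
    ‖((axialFn (pull (bgUnits F K W) (basePt F n K)) (blockBase ((F.P K).L ^ (K - n)) ((blockMap (F.P K).L)^[K - n] z - fun i => ((δ i : ℕ) : ℤ))) z
        * pull (bgUnits F K W) (basePt F n K) z μ
        * (axialFn (pull (bgUnits F K W) (basePt F n K)) (blockBase ((F.P K).L ^ (K - n)) ((blockMap (F.P K).L)^[K - n] z - fun i => ((δ i : ℕ) : ℤ))) (z + e μ))⁻¹ :
          (Matrix (Fin 2) (Fin 2) ℂ)ˣ) : Matrix (Fin 2) (Fin 2) ℂ) - 1‖ ≤ 12 * ε * eta F n K := by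
  have hL : 0 < (F.P K).L := by have h := F.hL.2; show 0 < F.L; omega
  have hℓ : 0 < (F.P K).L ^ (K - n) := pow_pos hL _
  have he : 0 < ε := pos_of_regPr F hW
  have hη : 0 < eta F n K := eta_pos F n K
  set V := pull (bgUnits F K W) (basePt F n K) with hV
  have hVU : ∀ x κ, V x κ ∈ U1 (Matrix (Fin 2) (Fin 2) ℂ) := fun x κ => pull_bgUnits_mem_U1 W (basePt F n K) x κ
  have hP : ∀ (x : LSite (F.P K).d) (κ μ : Fin (F.P K).d), κ ≠ μ → ‖((hol V x (B7Prop1Explicit.plaqWord κ μ) : (Matrix (Fin 2) (Fin 2) ℂ)ˣ) : Matrix (Fin 2) (Fin 2) ℂ) - 1‖ ≤ pdev V :=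
    fun x κ μ _ => le_pdev hVU x κ μ
  rw [iterate_blockMap_apply]
  set ℓ : ℕ := (F.P K).L ^ (K - n) with hℓdef
  set c := blockBase ℓ (blockMap ℓ z - fun i => ((δ i : ℕ) : ℤ)) with hc
  have hcz : c ≤ z := root_le hℓ z δ
  have hR : ∀ i, z i - c i ≤ (2 * ℓ : ℕ) := fun i => by
    have := sub_root_le hℓ z δ i; rw [← hc] at this; push_cast; omega
  have h1 := norm_axialFrame_bond_sub_one_le hVU (pdev_nonneg V) hP c z hcz hR μ
  have hpd : pdev V ≤ 2 * ε * (eta F n K) ^ 2 := pdev_pull_le_of_regPr F n K hW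
  have hd : (((F.P K).d : ℕ) : ℝ) = 3 := by exact_mod_cast T3Family.P_d F K
  have hℓη : ((ℓ : ℕ) : ℝ) * eta F n K = 1 := by
    show (((F.L ^ (K - n) : ℕ) : ℝ)) * ((F.L : ℝ)⁻¹) ^ (K - n) = 1
    rw [Nat.cast_pow, ← mul_pow, mul_inv_cancel₀ (ne_of_gt (by exact_mod_cast lt_trans zero_lt_one F.hL.2 : (0:ℝ) < F.L)), one_pow]
  refine h1.trans ?_
  rw [hd]
  calc (3 : ℝ) * ((2 * ℓ : ℕ) : ℝ) * pdev V
      ≤ 3 * ((2 * ℓ : ℕ) : ℝ) * (2 * ε * (eta F n K) ^ 2) := mul_le_mul_of_nonneg_left hpd (by positivity)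
    _ = 12 * ε * eta F n K * (((ℓ : ℕ) : ℝ) * eta F n K) := by push_cast; ring
    _ = 12 * ε * eta F n K := by rw [hℓη, mul_one]

/-- ★★ **(M-FAT) — the own-box frame against a neighbouring tent frame at the same site, against the inverse coarse staircase of `T`, at `RegPr` + the (B3c) rider: `≤ (36 + 3·CT)·ε`**
(px3's ✓`norm_frameRatio_sub_inv_hol_treeWord_le` at `Wc := pull T 0`, `M := ℓ`, `a := pdev W♯ ≤ 2εη²`, `E := CT·ε` (`norm_pull_sub_hol_seg_le`), `R := 2ℓ`; numerals `|z − ℓY|₁ ≤ 3(ℓ−1)`,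
`3(ℓ−1)·(3·2ℓ)·2εη² ≤ 36ε`, `d·E = 3·CT·ε`; the coarse staircase read back on the torus by lit ✓`hol_pull` + ✓`transl_zero_eq_tcls`).  The `hfat` slot of ✓`norm_covTent_grad_le` at the member.
[cite: Balaban1985Averaging, pp.24–25, (43) p.24, (52)–(53) p.27; Balaban1985RegularSpaces, (1.3), (1.7) p.77] -/
theorem tentFrame_fat_of_regPr {ε : ℝ} {W : GaugeField (F.P K) 0 (Matrix.specialUnitaryGroup (Fin 2) ℂ)} (hW : RegPr F n K ε W) (hnK : n ≤ K) {CT : ℝ} (hCT : 0 ≤ CT)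
    (T : PBond (F.P K) (K - n) → (Matrix (Fin 2) (Fin 2) ℂ)ˣ) (hT : ∀ c, T c ∈ U1 (Matrix (Fin 2) (Fin 2) ℂ))
    (hclose : ∀ c : PBond (F.P K) (K - n),
      ‖(T c : Matrix (Fin 2) (Fin 2) ℂ) - ((holT (unitsField (toUField W)) (transl (basePt F n K) (blockBase ((F.P K).L ^ (K - n)) (tlift c.src)))
          (List.replicate ((F.P K).L ^ (K - n)) (c.dir, true)) : (Matrix (Fin 2) (Fin 2) ℂ)ˣ) : Matrix (Fin 2) (Fin 2) ℂ)‖ ≤ CT * ε)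
    (z : LSite (F.P K).d) (δ : Fin (F.P K).d → Fin 2) :
    ‖((axialFn (pull (bgUnits F K W) (basePt F n K)) (blockBase ((F.P K).L ^ (K - n)) ((blockMap (F.P K).L)^[K - n] z)) z
        * (axialFn (pull (bgUnits F K W) (basePt F n K)) (blockBase ((F.P K).L ^ (K - n)) ((blockMap (F.P K).L)^[K - n] z - fun i => ((δ i : ℕ) : ℤ))) z)⁻¹ :
          (Matrix (Fin 2) (Fin 2) ℂ)ˣ) : Matrix (Fin 2) (Fin 2) ℂ)
      - (((holT T (tcls ((F.P K).sitesPerDir (K - n)) ((blockMap (F.P K).L)^[K - n] z - fun i => ((δ i : ℕ) : ℤ))) (treeWord (fun i => ((δ i : ℕ) : ℤ))))⁻¹ :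
          (Matrix (Fin 2) (Fin 2) ℂ)ˣ) : Matrix (Fin 2) (Fin 2) ℂ)‖ ≤ (36 + 3 * CT) * ε := by
  have hL : 0 < (F.P K).L := by have h := F.hL.2; show 0 < F.L; omega
  have hℓ : 0 < (F.P K).L ^ (K - n) := pow_pos hL _
  have he : 0 < ε := pos_of_regPr F hW
  have hη : 0 < eta F n K := eta_pos F n K
  set ℓ : ℕ := (F.P K).L ^ (K - n) with hℓdef
  set V := pull (bgUnits F K W) (basePt F n K) with hV
  have hVU : ∀ x κ, V x κ ∈ U1 (Matrix (Fin 2) (Fin 2) ℂ) := fun x κ => pull_bgUnits_mem_U1 W (basePt F n K) x κ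
  have hP : ∀ (x : LSite (F.P K).d) (κ μ : Fin (F.P K).d), κ ≠ μ → ‖((hol V x (B7Prop1Explicit.plaqWord κ μ) : (Matrix (Fin 2) (Fin 2) ℂ)ˣ) : Matrix (Fin 2) (Fin 2) ℂ) - 1‖ ≤ pdev V :=
    fun x κ μ _ => le_pdev hVU x κ μ
  set Wc : LSite (F.P K).d → Fin (F.P K).d → (Matrix (Fin 2) (Fin 2) ℂ)ˣ := pull T 0 with hWc
  have hWcU : ∀ x κ, Wc x κ ∈ U1 (Matrix (Fin 2) (Fin 2) ℂ) := fun x κ => pull_mem_U1_of F K hT 0 x κ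
  have hE : 0 ≤ CT * ε := mul_nonneg hCT he.le
  have hbond : ∀ (Y : LSite (F.P K).d) (κ : Fin (F.P K).d),
      ‖((Wc Y κ : (Matrix (Fin 2) (Fin 2) ℂ)ˣ) : Matrix (Fin 2) (Fin 2) ℂ) - ((hol V ((ℓ : ℤ) • Y) (seg κ (ℓ : ℤ)) : (Matrix (Fin 2) (Fin 2) ℂ)ˣ) : Matrix (Fin 2) (Fin 2) ℂ)‖ ≤ CT * ε :=
    fun Y κ => norm_pull_sub_hol_seg_le F n K hnK W T hclose Y κ
  -- the site's box label and the roots in `•` letters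
  rw [iterate_blockMap_apply]
  set Y : LSite (F.P K).d := blockMap ℓ z with hY
  set v : LSite (F.P K).d := fun i => ((δ i : ℕ) : ℤ) with hv
  have hYz : (ℓ : ℤ) • Y ≤ z := by
    intro i; have := (offset_mem hℓ z i).1; simp only [Pi.smul_apply, smul_eq_mul, hY]; linarith
  have hR : ∀ i, z i - ((ℓ : ℤ) • (Y - v)) i ≤ (2 * ℓ : ℕ) := fun i => by
    have h := sub_root_le hℓ z δ i
    simp only [blockBase, Pi.sub_apply] at h
    simp only [Pi.smul_apply, Pi.sub_apply, smul_eq_mul]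
    push_cast; linarith
  have h := norm_frameRatio_sub_inv_hol_treeWord_le hWcU hVU (pdev_nonneg V) hP ℓ hE hbond Y z δ hYz hR
  -- read the two sides back in `blockBase`∕`holT` letters
  have e1 : blockBase ℓ Y = (ℓ : ℤ) • Y := blockBase_eq_smul ℓ Y
  have e2 : blockBase ℓ (Y - v) = (ℓ : ℤ) • (Y - v) := blockBase_eq_smul ℓ _
  have e3 : holT T (tcls ((F.P K).sitesPerDir (K - n)) (Y - v)) (treeWord v) = hol Wc (Y - v) (treeWord v) := by
    rw [hWc, hol_pull, transl_zero_eq_tcls]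
  rw [e1, e2, e3]
  refine h.trans ?_
  -- numerals
  have hpd : pdev V ≤ 2 * ε * (eta F n K) ^ 2 := pdev_pull_le_of_regPr F n K hW
  have hd : (((F.P K).d : ℕ) : ℝ) = 3 := by exact_mod_cast T3Family.P_d F K
  have hℓη : ((ℓ : ℕ) : ℝ) * eta F n K = 1 := by
    show (((F.L ^ (K - n) : ℕ) : ℝ)) * ((F.L : ℝ)⁻¹) ^ (K - n) = 1
    rw [Nat.cast_pow, ← mul_pow, mul_inv_cancel₀ (ne_of_gt (by exact_mod_cast lt_trans zero_lt_one F.hL.2 : (0:ℝ) < F.L)), one_pow]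
  have hl1 : (l1 (z - (ℓ : ℤ) • Y) : ℝ) ≤ 3 * ((ℓ : ℝ) - 1) := by
    have h1 := l1_sub_blockBase_blockMap_le (d := (F.P K).d) hℓ z
    rw [← hY, e1] at h1
    have h1' : ((l1 (z - (ℓ : ℤ) • Y) : ℕ) : ℝ) ≤ (((F.P K).d : ℕ) : ℝ) * (((ℓ - 1 : ℕ)) : ℝ) := by exact_mod_cast h1
    have hℓ1 : 1 ≤ ℓ := hℓ
    rw [hd, Nat.cast_sub hℓ1, Nat.cast_one] at h1'
    exact h1'
  have hℓr : (1 : ℝ) ≤ (ℓ : ℝ) := by exact_mod_cast hℓ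
  rw [hd]
  have hpd' : ((3 : ℝ) * ((2 * ℓ : ℕ) : ℝ)) * pdev V ≤ 12 * ε * eta F n K := by
    calc ((3 : ℝ) * ((2 * ℓ : ℕ) : ℝ)) * pdev V ≤ ((3 : ℝ) * ((2 * ℓ : ℕ) : ℝ)) * (2 * ε * (eta F n K) ^ 2) := mul_le_mul_of_nonneg_left hpd (by positivity)
      _ = 12 * ε * eta F n K * (((ℓ : ℕ) : ℝ) * eta F n K) := by push_cast; ring
      _ = 12 * ε * eta F n K := by rw [hℓη, mul_one]
  have hA : (l1 (z - (ℓ : ℤ) • Y) : ℝ) * (((3 : ℝ) * ((2 * ℓ : ℕ) : ℝ)) * pdev V) ≤ 36 * ε := by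
    calc (l1 (z - (ℓ : ℤ) • Y) : ℝ) * (((3 : ℝ) * ((2 * ℓ : ℕ) : ℝ)) * pdev V)
        ≤ (3 * ((ℓ : ℝ) - 1)) * (12 * ε * eta F n K) := mul_le_mul hl1 hpd' (mul_nonneg (by positivity) (pdev_nonneg V)) (by linarith)
      _ = 36 * ε * (((ℓ : ℕ) : ℝ) * eta F n K) - 36 * ε * eta F n K := by ring
      _ = 36 * ε - 36 * ε * eta F n K := by rw [hℓη, mul_one]
      _ ≤ 36 * ε := by nlinarith [mul_pos he hη]
  have hB : (3 : ℝ) * (CT * ε) = 3 * CT * ε := by ring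
  linarith [hA, hB]

/-- ★★ **(M-REP) — print's comb transporter against the own-box frame, ratio form, + unit-ball membership, at `RegPr` within the L-only radius `e₃ L := min (6·C₀(3))⁻¹ (c₂′(3,L)∕4)`**
(px5 g6's ★★★ ✓`norm_compT_bgT_sub_axialFn_le` at `α₀ := 2ε` over the `SU(2)`-closed tower ✓`avgClosed_specialUnitary_of_le_twentyone`, `pdev W♯ < 2ε·ℓ⁻²` ✓`pdev_pull_lt`∘✓`inAk_pull_of_regPr`;
membership from ✓`bgT_pull_mem_unitaryUnits_of_regPr`; `‖τσ⁻¹ − 1‖ ≤ ‖τ − σ‖`).  The reproduction transporter slot of F4-B. [cite: Balaban1985BackgroundPropagators, (3.19) p.393; Balaban1985Averaging, (52)–(54) p.26, (78)–(80) p.30] -/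
theorem tentFrame_rep_of_regPr : ∀ (L : ℕ), 1 < L → ∃ e₃ : ℝ, 0 < e₃ ∧
    ∀ (F : T3Family), F.L = L → ∀ (n K : ℕ), n ≤ K → ∀ (ε : ℝ) (W : GaugeField (F.P K) 0 (Matrix.specialUnitaryGroup (Fin 2) ℂ)), 0 < ε → ε ≤ e₃ → RegPr F n K ε W →
      ∀ (Y z : LSite (F.P K).d), z ∈ blockIter (F.P K).L (K - n) Y →
        compT (F.P K).L (bgT (F.P K).L (pull (bgUnits F K W) (basePt F n K))) (K - n) Y z ∈ U1 (Matrix (Fin 2) (Fin 2) ℂ) ∧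
        ‖((compT (F.P K).L (bgT (F.P K).L (pull (bgUnits F K W) (basePt F n K))) (K - n) Y z
            * (axialFn (pull (bgUnits F K W) (basePt F n K)) (blockBase ((F.P K).L ^ (K - n)) Y) z)⁻¹ : (Matrix (Fin 2) (Fin 2) ℂ)ˣ) : Matrix (Fin 2) (Fin 2) ℂ) - 1‖
          ≤ (87 * 3 * (3 + 1) * (3 + 4)) * (2 * ε) := by
  intro L hL
  have hL1 : 1 ≤ L := hL.le
  have hC0 : 0 < C0 3 := C0_pos 3
  have hc2 : 0 < c2' 3 L := c2'_pos 3 L hL1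
  refine ⟨min (6 * C0 3)⁻¹ (c2' 3 L / 4), lt_min (by positivity) (by positivity), ?_⟩
  intro F hF n K hnK ε W he he3 hW Y z hz
  have hd : (F.P K).d = 3 := T3Family.P_d F K
  have hFL : (F.P K).L = L := hF
  have hL2 : 2 ≤ (F.P K).L := by rw [hFL]; omega
  have he1 : ε ≤ (6 * C0 3)⁻¹ := he3.trans (min_le_left _ _)
  have he2 : ε ≤ c2' 3 L / 4 := he3.trans (min_le_right _ _)
  have hα : 0 < 2 * ε := by positivity
  have hα3 : C0 (F.P K).d * (2 * ε) ≤ 1 / 3 := by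
    rw [hd]
    have : C0 3 * ε ≤ C0 3 * (6 * C0 3)⁻¹ := mul_le_mul_of_nonneg_left he1 hC0.le
    have h6 : C0 3 * (6 * C0 3)⁻¹ = 1 / 6 := by field_simp
    linarith
  have hα2 : 2 * (2 * ε) ≤ c2' (F.P K).d (F.P K).L := by rw [hd, hFL]; linarith
  have hα4 : 4 * ε ≤ c2' (F.P K).d (F.P K).L := by linarith
  set V := pull (bgUnits F K W) (basePt F n K) with hV
  have hVU : ∀ x κ, V x κ ∈ U1 (Matrix (Fin 2) (Fin 2) ℂ) := fun x κ => pull_bgUnits_mem_U1 W (basePt F n K) x κ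
  have hG := avgClosed_specialUnitary_of_le_twentyone (N := 2) (by norm_num) (F.P K).d (F.P K).L
  have hVmem : ∀ x κ, V x κ ∈ B7Prop2SpecialUnitary.specialUnitaryUnits (Fin 2) := pull_toUField_mem W (basePt F n K)
  have h52 : pdev V < 2 * ε * ((((F.P K).L : ℝ) ^ (K - n))⁻¹) ^ 2 := pdev_pull_lt he (inAk_pull_of_regPr F he.le hW) (basePt F n K)
  have hmain := norm_compT_bgT_sub_axialFn_le (F.P K).L hL2 hG V hVmem (K - n) hα hα3 hα2 h52 Y z hz
  -- membership
  have hlegs : ∀ j, j < K - n → ∀ y x : LSite (F.P K).d, bgT (F.P K).L V j y x ∈ U1 (Matrix (Fin 2) (Fin 2) ℂ) := fun j hj y x => by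
    letI : CStarAlgebra (Matrix (Fin 2) (Fin 2) ℂ) := B10Eq29TubeLine.cstarAlgebraMatrix 2
    exact unitaryUnits_le_U1 (bgT_pull_mem_unitaryUnits_of_regPr F (n := n) he hα3 hα4 hW j hj.le y x)
  have hmem : compT (F.P K).L (bgT (F.P K).L V) (K - n) Y z ∈ U1 (Matrix (Fin 2) (Fin 2) ℂ) := compT_mem_U1 (F.P K).L _ hlegs (K - n) le_rfl Y z
  refine ⟨hmem, ?_⟩
  have hσ : axialFn V (blockBase ((F.P K).L ^ (K - n)) Y) z ∈ U1 (Matrix (Fin 2) (Fin 2) ℂ) := axialFn_mem hVU _ _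
  refine (norm_mul_inv_sub_one_le hσ).trans (hmain.trans (le_of_eq ?_))
  have hd' : (((F.P K).d : ℕ) : ℝ) = 3 := by exact_mod_cast hd
  rw [hd']

end Member

end Summit.QuantumFields.YangMills.Theorems.Prop7TentFrameRowsOfRegPr

end
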